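import Literature.IUT.HodgeArakelov.IotaInvariantThetaInftyModel
import Literature.IUT.HodgeArakelov.EtaleThetaDataSignTransport
import Literature.IUT.HodgeArakelov.CohomologyAutFunctorialityComp
import Literature.AnabelianGeometry.EtaleTheta.ThetaKummerClass
import Literature.AnabelianGeometry.EtaleTheta.KummerContH1Conj

/-!
# [IUTchII] Prop 2.2 (ii) «respectively» clause AT THE MODEL: the divisibility input `hdiv`
# (roots of the θ-classes in `lim_J H¹(Π_Ÿ(Π_v)∣_J, (l·Δ_Θ)(Π_v))`) from Kummer theory of the roots of `Θ̈`

Proof-only companion (abc-iut cell, D-0067 wave 4, cone of [IUTchIII] Cor. 3.12; DAG node **IUTchII:Prop2.2(ii)**,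
«respectively» clause; no definitions, no `Prop`-valued facts; seat abc-iut-w4-d010 gen 2, holder-opened sub-row
«hdiv at the model»). S. Mochizuki, *Inter-universal Teichmüller theory II*, kurims manuscript (Dec. 2020) §1,
Prop. 1.4 p. 27 l. 24–27 («`∞θ(Π)` denotes the subset of elements of the direct limit of cohomology modules in the
display for which some [positive integer] multiple … coincides, up to torsion, with an element of `θ(Π)`; `J` ranges
over the finite index open subgroups of `Π`» — the emphasis on «up to torsion» below is OURS) and §2, Prop. 2.2 (ii)
p. 66 l. 56–61 (claim key `Mochizuki2012`, DISPUTED, D-0012); [EtTh] (S. Mochizuki, Publ. RIMS **45** (2009),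
refereed) §1 pp. 18–20 (the `N`-th roots of `Θ̈` on the tempered coverings `Z̈_N` — our paraphrase of the construction,
not print's wording), Prop. 1.3 p. 21 (Kummer classes), Def. 2.7 p. 41 (the `l`-th root class
`η̲̈^Θ ∈ H¹(Π^tp_Ÿ̲̲, l·Δ_Θ)`).

WHAT IS HERE.
§1 (generic, over abc-iut-L6-t1's `cohomologySystemOfContH1 φ A H`): `exists_nsmul_sub_toLim_isOfFinAddOrder_of_res`
   — if a class `y ∈ H¹(H, A)` has, after restriction to some finite-index open `J`, an `N`-th root `z ∈ H¹(H ⊓ J, A)`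
   UP TO TORSION, then `toLim ⊤ y` has an `N`-th root up to torsion in the limit (colimit bookkeeping).
§2 (generic, over the repaired interface `IotaInvariantTheta'` of abc-iut-L6-t19/w5-d187): the «respectively»
   clause (3) and the assembled `InftyClause` from the WEAKER divisibility input
   «`∀ t ∈ θ(Π_v), ∀ N > 0, ∃ x, N • x − toLim t` is torsion» (`hdiv'`) — print's own wording is "up to torsion"
   (Prop. 1.4 p. 27), and w5-d187's route (`exists_mem_thetaInftyIota_of_level`) goes through verbatim:
   `exists_mem_thetaInftyIota_of_level_of_torsionRoot`, `inftyClause_of_ker_torsion_of_torsionRoot`.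
§3 (the model `Π_v := Π^tp_X̲̲`, `D := etaleThetaDataOfSetting'`): `hdiv'` PROVED from Kummer theory of the roots of
   `Θ̈` on abc-iut-L2-t12's `ThetaKummerInput T` — inputs: `E.etaDd = T.kummerTheta` (route R-8/R-9, as in
   abc-iut-w5-d125's files) and ONE function-level hypothesis `hJ`: «every root `Θ̈^{1/M}` (a member of the compatible
   root system `T.thetaRoots`) is fixed by `Π_Ÿ(Π_v) ∩ J` for some finite-index open `J ≤ Π_v`» ([EtTh] §1 p. 20:
   the roots live on the finite coverings `Z̈_M`; [IUTchII] Prop. 1.4: «`J` ranges over the finite index open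
   subgroups of `Π`»). Route: for `o = σ·η̲̈^Θ` in the orbit and `N > 0`, on `J` fixing the `lN`-th root `r` of `σ•Θ̈`
   the `l`-th POWER of the Kummer cocycle of `r` is an `l·Δ_Θ`-valued continuous cocycle `z` (§3b) whose `N`-th power
   has the same `Δ_Θ`-image as `res_J o` (both are the Kummer class of `σ•Θ̈`: abc-iut-w5-d125's
   `conj_kummerContClass`, abc-iut-L2-t8's `conj_coeffChange_rootLiftClass`), hence `z^N / res_J o` is `l`-torsion
   (abc-iut-w4-d014's `pow_l_eq_one_of_coeffChange_eq_one`); a general `t ∈ θ(Π_v)` is `−o +` an `l`-torsion class.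
   Closing theorems: `hdivTorsion_etaleThetaDataOfSetting'` and **`inftyClause_etaleThetaDataOfSetting'_of_thetaKummer`**
   (= w5-d187's `inftyClause_etaleThetaDataOfSetting'` with the binder `hdiv` DISCHARGED; residual `hfix` + `hη` + `hJ`).
HONEST FRAMING: `hfix` (no nontrivial `Π_Ÿ ∩ K'`-fixed element of `l·Δ_Θ` — the cyclotomic character on open subgroups)
stays a binder; `Fn` has no carrier, so `hη`/`hJ` are hypotheses on t12's data like `theta_mem`; [EtTh] is refereed;
nothing here takes a side on [IUTchIII] Cor. 3.12; typed ≠ proved for the inputs.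
-/

namespace Literature.IUT.HodgeArakelov

open Literature.AnabelianGeometry.EtaleTheta (ContH1 contCocycles ThetaSetting RootSystem cyclotome)
open Literature.AnabelianGeometry.EtaleTheta
open CohomologySystemOfContH1

universe u

noncomputable section

/-! ## §1. Colimit bookkeeping: a finite-level root up to torsion gives a root up to torsion in the limit -/

section Generic

variable {P : TopGroup.{u}} {G' : Type u} [Group G'] [TopologicalSpace G'] [IsTopologicalGroup G']
  (φ : P →* G') (A : Subgroup G') [A.Normal] [IsMulCommutative A] (H : Subgroup P)

/-- **A finite-level `N`-th root up to torsion gives an `N`-th root up to torsion in the limit.** For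
`y ∈ H¹(H ⊓ ⊤, A)`, a finite-index open `J ≤ Π` and `z ∈ H¹(H ⊓ J, A)` with `z^N / res_J y` of finite order, the image
of `y` in `lim_K H¹(H ⊓ K, A)` (through `H1 ⊤ ≅ H¹(H ⊓ ⊤, A)`) has an `N`-th root up to torsion: the colimit class of
`z`. [cite: Mochizuki2012, Prop 1.4 p.27] -/
theorem exists_nsmul_sub_toLim_isOfFinAddOrder_of_res (J : Subgroup P) (hJ : J.FiniteIndex)
    (hJo : IsOpen (J : Set P)) (y : ContH1 φ A (H ⊓ ⊤)) (z : ContH1 φ A (H ⊓ J)) (N : ℕ)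
    (h : IsOfFinOrder (z ^ N / ContH1.res φ A (inf_le_inf_left H (le_top : J ≤ ⊤)) y)) :
    ∃ x : (cohomologySystemOfContH1 φ A H).lim, IsOfFinAddOrder (N • x -
      (cohomologySystemOfContH1 φ A H).toLim ⊤
        ((h1EquivOfFiniteIndexOpen φ A H ⊤ inferInstance (by simp)).symm (Additive.ofMul y))) := by
  let j : Idx (P := P) ⊥ := (Idx.self J hJ hJo).incl bot_le
  let i : Idx (P := P) ⊥ := (Idx.self (⊤ : Subgroup P) inferInstance (by simp)).incl bot_le
  have hij : i ≤ j := (le_top : J ≤ ⊤)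
  -- the computation inside `h1Lim φ A H ⊥` (= the system's `lim`)
  have key : IsOfFinAddOrder
      (N • h1Of φ A H ⊥ j (Additive.ofMul z) - h1Of φ A H ⊥ i (Additive.ofMul y)) := by
    rw [← h1Of_fmod φ A H ⊥ hij (Additive.ofMul y), ← map_nsmul, ← map_sub]
    refine (h1Of φ A H ⊥ j).isOfFinAddOrder ?_
    exact isOfFinAddOrder_ofMul_iff.mpr h
  have e := toLim_h1Equiv_symm φ A H ⊤ inferInstance (by simp) (Additive.ofMul y)
  refine ⟨h1Of φ A H ⊥ j (Additive.ofMul z), ?_⟩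
  rw [e]
  exact key

end Generic

/-! ## §2. The «respectively» clause from divisibility UP TO TORSION (generic over `IotaInvariantTheta'`) -/

namespace IotaInvariantTheta'

variable {S : BadPlaceSetting.{u}} {P : TopGroup.{u}} {T : TemperedCoverings S P}
  {D : EtaleThetaData S.toThetaSetting P} {Dec : SubgraphDecomposition S T D} (Θ : IotaInvariantTheta' Dec)

/-- **IUTchII:Prop2.2(ii)** «respectively» clause (3) «within EACH `{(l·ℤ) × μ}`-orbit» from divisibility UP TO
TORSION: if every class of `θ(Π_v)` has, for every `N > 0`, an `N`-th root up to torsion in the limit (print,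
Prop. 1.4 p. 27: «some [positive integer] multiple … coincides, up to torsion, with an element of `θ(Π)`»), then
every positive
root level contains a member of `∞θ^ι(Π_v)`. Same route as abc-iut-w5-d187's `exists_mem_thetaInftyIota_of_level`:
an `N`-th root (up to torsion) of an `ι`-invariant class is `ι`-invariant up to torsion.
[claim: Mochizuki2012, status: disputed] (IUTchII §2 Prop 2.2 (ii), kurims p.66) -/
theorem exists_mem_thetaInftyIota_of_level_of_torsionRoot
    (hdiv' : ∀ t ∈ D.theta, ∀ N : ℕ, 0 < N → ∃ x : D.coh.lim, IsOfFinAddOrder (N • x - D.coh.toLim ⊤ t))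
    {N : ℕ} (hN : 0 < N) : ∃ x' ∈ Θ.thetaInftyIota, D.IsRootOfLevel N x' := by
  obtain ⟨t₀, ht₀, hinv₀⟩ := Θ.thetaIota_nonempty
  obtain ⟨x, hx⟩ := hdiv' t₀ ht₀ N hN
  refine ⟨x, ⟨⟨N, hN, t₀, ht₀, hx⟩, ?_⟩, t₀, ht₀, hx⟩
  -- `N • (ι x − x) = ι(N•x − L t₀) + (−(N•x − L t₀)) + L(ι t₀ − t₀)` is torsion
  have h1 : N • (Θ.iotaLim x - x) =
      Θ.iotaLim (N • x - D.coh.toLim ⊤ t₀) + -(N • x - D.coh.toLim ⊤ t₀) + D.coh.toLim ⊤ (Θ.iotaH1 t₀ - t₀) := by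
    rw [smul_sub, ← map_nsmul, map_sub, map_sub, Θ.iota_compat]
    abel
  have h2 : IsOfFinAddOrder (N • (Θ.iotaLim x - x)) := by
    rw [h1]
    exact ((Θ.iotaLim.toAddMonoidHom.isOfFinAddOrder hx).add hx.neg).add
      ((D.coh.toLim ⊤).isOfFinAddOrder hinv₀)
  exact h2.of_nsmul hN.ne'

/-- **IUTchII:Prop2.2(ii)** «respectively» clause ASSEMBLED from (hker) `Ker(H¹ → lim)` torsion and the divisibility
UP TO TORSION `hdiv'`. [claim: Mochizuki2012, status: disputed] (IUTchII §2 Prop 2.2 (ii), kurims p.66) -/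
theorem inftyClause_of_ker_torsion_of_torsionRoot
    (hker : ∀ y : D.coh.H1 ⊤, D.coh.toLim ⊤ y = 0 → IsOfFinAddOrder y)
    (hdiv' : ∀ t ∈ D.theta, ∀ N : ℕ, 0 < N → ∃ x : D.coh.lim, IsOfFinAddOrder (N • x - D.coh.toLim ⊤ t)) :
    Θ.InftyClause :=
  ⟨Θ.thetaInftyIota_nonempty,
    fun _ hx _ hx' h => Θ.isOfFinAddOrder_sub_of_sameRootLevel hker hx hx' h,
    fun _ hN _ => Θ.exists_mem_thetaInftyIota_of_level_of_torsionRoot hdiv' hN⟩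

end IotaInvariantTheta'

/-! ## §3. At the model `Π_v := Π^tp_X̲̲`: Kummer divisibility of the θ-classes up to torsion -/

namespace EtaleThetaDataOfSetting

variable {p : ℕ} [Fact p.Prime] {D : Literature.AnabelianGeometry.EtaleTheta.ThetaSetting p}
  {E : D.EtaleThetaData} {l : ℕ} (C : E.DoubleUnderline l) [hN : (PiYdd C).Normal] [hYN : D.GtpYdd.Normal]

/-! ### §3a. Levels: transporting a finite-index open level along `σ ∈ Π` -/

omit hYN in
/-- If some finite-index open `J ≤ Π` has `Π_Ÿ(Π) ∩ J` fixing `f`, then (`Π_Ÿ(Π)` being normal) the conjugate level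
`σJσ⁻¹` is finite-index open and `Π_Ÿ(Π) ∩ σJσ⁻¹` fixes `σ • f`. [cite: Mochizuki2012, Prop 1.4 p.27] -/
theorem exists_level_fixing_smul {F : Type} [MulAction D.PiTemp F] (σ : Pi C) (f : F)
    (hJ : ∃ J : Subgroup (Pi C), J.FiniteIndex ∧ IsOpen (J : Set (Pi C)) ∧
      ∀ g : Pi C, g ∈ PiYdd C ⊓ J → (g : D.PiTemp) • f = f) :
    ∃ J : Subgroup (Pi C), J.FiniteIndex ∧ IsOpen (J : Set (Pi C)) ∧
      ∀ g : Pi C, g ∈ PiYdd C ⊓ J → (g : D.PiTemp) • ((σ : D.PiTemp) • f) = (σ : D.PiTemp) • f := by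
  obtain ⟨J, hJf, hJo, hfix⟩ := hJ
  refine ⟨J.map (MulAut.conj σ).toMonoidHom, ?_, ?_, ?_⟩
  · exact Subgroup.finiteIndex_iff.mpr (by
      rw [Subgroup.index_map_of_bijective (f := (MulAut.conj σ).toMonoidHom) (MulAut.conj σ).bijective]
      exact hJf.index_ne_zero)
  · have heq : ((J.map (MulAut.conj σ).toMonoidHom : Subgroup (Pi C)) : Set (Pi C)) =
        (fun g : Pi C => σ⁻¹ * g * σ⁻¹⁻¹) ⁻¹' (J : Set (Pi C)) := by
      ext g
      simp only [Subgroup.coe_map, MulEquiv.coe_toMonoidHom, MulAut.conj_apply, Set.mem_image,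
        SetLike.mem_coe, Set.mem_preimage, inv_inv]
      constructor
      · rintro ⟨y, hy, rfl⟩
        simpa [mul_assoc] using hy
      · intro hg
        exact ⟨σ⁻¹ * g * σ, hg, by group⟩
    rw [heq]
    exact hJo.preimage (by fun_prop)
  · intro g hg
    obtain ⟨hgY, hgJ⟩ := Subgroup.mem_inf.mp hg
    obtain ⟨y, hy, hyg⟩ := Subgroup.mem_map.mp hgJ
    rw [MulEquiv.coe_toMonoidHom, MulAut.conj_apply] at hyg
    have hyY : y ∈ PiYdd C := by
      have hy' : y = σ⁻¹ * g * σ⁻¹⁻¹ := by rw [← hyg]; group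
      rw [hy']
      exact hN.conj_mem g hgY σ⁻¹
    have hfy := hfix y (Subgroup.mem_inf.mpr ⟨hyY, hy⟩)
    rw [← hyg, Subgroup.coe_mul, Subgroup.coe_mul, Subgroup.coe_inv, mul_smul, mul_smul, inv_smul_smul, hfy]

/-! ### §3b. The `Δ_Θ`-image of a restricted orbit class is the Kummer class of a translate of `Θ̈` -/

omit hN in
/-- The `Δ_Θ`-image of `res_J (σ·η̲̈^Θ)` is the pull-back to `Π_Ÿ(Π) ∩ J` of `σ·η̈^Θ` (abc-iut-L2-t8's
`conj_coeffChange_rootLiftClass`, restricted). [cite: MochizukiEtTh2009, Def 2.7 p.41] -/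
theorem coeffChange_res_conj_rootLiftClass [hN : (PiYdd C).Normal] (J : Subgroup (Pi C)) (σ : Pi C) :
    ContH1.coeffChange (phi C) (D.lDeltaTheta_le l) (PiYdd C ⊓ J)
        (ContH1.res (phi C) (D.lDeltaTheta l) (inf_le_inf_left (PiYdd C) (le_top : J ≤ ⊤))
          (ContH1.conj (phi C) (D.lDeltaTheta l) σ (rootLiftClass C))) =
      ContH1.comap D.toTheta D.DeltaTheta C.Huu.subtype continuous_subtype_val
        (map_subtype_piYdd_inf_le_GtpYdd C J) (ContH1.conj D.toTheta D.DeltaTheta (σ : D.PiTemp) E.etaDd) := by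
  rw [← ContH1.res_coeffChange, ← ContH1.conj_coeffChange, conj_coeffChange_rootLiftClass,
    ContH1.res_comap D.toTheta D.DeltaTheta C.Huu.subtype continuous_subtype_val
      (map_subtype_piYdd_inf_le_GtpYdd C ⊤) (map_subtype_piYdd_inf_le_GtpYdd C J)
      (inf_le_inf_left (PiYdd C) (le_top : J ≤ ⊤)) (le_refl _),
    ContH1Aut.res_self_apply]

/-! ### §3c. An orbit class has `N`-th roots up to torsion at a level where the `lN`-th root of `Θ̈` lives -/

/-- **`σ·η̲̈^Θ` has an `N`-th root UP TO TORSION at every finite-index open level `J` on which the `lN`-th root of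
`σ•Θ̈` is defined** (`N > 0`, `η̈^Θ = κ(Θ̈)`): the class `z` of the `l`-th POWER of the Kummer cocycle of that root —
an `l·Δ_Θ`-valued continuous cocycle on `Π_Ÿ(Π) ∩ J` — satisfies `(z^N / res_J (σ·η̲̈^Θ))^l = 1`, since both `z^N`
and `res_J (σ·η̲̈^Θ)` have `Δ_Θ`-image the Kummer class of `σ•Θ̈` (the `lN`-th power of the Kummer cocycle of the
`lN`-th root IS the Kummer cocycle of `σ•Θ̈`) and the kernel of the change of coefficients is `l`-torsion.
[cite: MochizukiEtTh2009, Prop 1.3 p.21] -/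
theorem exists_pow_div_res_conj_rootLiftClass_torsion (T : D.ThetaKummerInput) (hη : E.etaDd = T.kummerTheta)
    (σ : Pi C) {N : ℕ} (hN : 0 < N) (J : Subgroup (Pi C))
    (hfix : ∀ g : Pi C, g ∈ PiYdd C ⊓ J →
      (g : D.PiTemp) • ((σ : D.PiTemp) • T.thetaRoots.root ⟨l * N, Nat.mul_pos (Nat.pos_of_ne_zero C.l_ne_zero) hN⟩) =
        (σ : D.PiTemp) • T.thetaRoots.root ⟨l * N, Nat.mul_pos (Nat.pos_of_ne_zero C.l_ne_zero) hN⟩) :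
    ∃ z : ContH1 (phi C) (D.lDeltaTheta l) (PiYdd C ⊓ J),
      IsOfFinOrder (z ^ N / ContH1.res (phi C) (D.lDeltaTheta l) (inf_le_inf_left (PiYdd C) (le_top : J ≤ ⊤))
        (ContH1.conj (phi C) (D.lDeltaTheta l) σ (rootLiftClass C))) := by
  -- the translate `σ•Θ̈`, its root system, and the `lN`-th root `b`
  set M : ℕ+ := ⟨l * N, Nat.mul_pos (Nat.pos_of_ne_zero C.l_ne_zero) hN⟩ with hM
  let x' : RootSystem ((σ : D.PiTemp) • T.theta) := T.thetaRoots.smul (σ : D.PiTemp)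
  have ha' : (σ : D.PiTemp) • T.theta ∈ MulAction.fixedPoints D.GtpYdd T.Fn :=
    CyclotomeCoefficients.smul_mem_fixedPoints_of_normal (H := D.GtpYdd) (σ : D.PiTemp) T.theta_mem
  have hx' : ∀ n : ℕ+, IsOpen (MulAction.stabilizer D.PiTemp (x'.root n) : Set D.PiTemp) :=
    CyclotomeCoefficients.isOpen_stabilizer_smul_root (σ : D.PiTemp) T.thetaRoots (fun _ => T.isOpen_stabilizer _)
  -- the level subgroup `H' = Π_Ÿ(Π) ∩ J` inside `Π^tp_X`, which fixes `b := x'.root M`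
  let H' : Subgroup D.PiTemp := (PiYdd C ⊓ J).map C.Huu.subtype
  have hmem : ∀ g : ↥(PiYdd C ⊓ J), ((g : Pi C) : D.PiTemp) ∈ H' := fun g => ⟨g, g.2, rfl⟩
  have hb : x'.root M ∈ MulAction.fixedPoints H' T.Fn := by
    rintro ⟨_, g, hg, rfl⟩
    change ((g : Pi C) : D.PiTemp) • x'.root M = x'.root M
    rw [RootSystem.smul_root]
    exact hfix g hg
  -- a compatible root system of `b`: `n ↦ x'.root (M n)`
  let y : RootSystem (x'.root M) :=
    ⟨fun n => x'.root (M * n), by rw [mul_one], fun n m => by rw [← mul_assoc]; exact x'.root_mul_pow (M * n) m⟩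
  have hy : ∀ n : ℕ+, IsOpen (MulAction.stabilizer D.PiTemp (y.root n) : Set D.PiTemp) := fun n => hx' (M * n)
  -- the Kummer cocycle of `b` on `H'`, and its `l`-th power as an `l·Δ_Θ`-valued cocycle on `Π_Ÿ(Π) ∩ J`
  let κ := T.coeff.kummerContCocycle H' y hb hy
  let F : ↥(PiYdd C ⊓ J) → ↥(D.lDeltaTheta l) := fun g =>
    ⟨((κ.1 ⟨((g : Pi C) : D.PiTemp), hmem g⟩ : D.DeltaTheta) : D.GtpTheta) ^ l, pow_mem_lDeltaTheta _⟩
  have hF : F ∈ contCocycles (phi C) (D.lDeltaTheta l) (PiYdd C ⊓ J) := by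
    refine ⟨Continuous.subtype_mk ((continuous_pow l).comp (continuous_subtype_val.comp (κ.2.1.comp
      (Continuous.subtype_mk (continuous_subtype_val.comp continuous_subtype_val) _)))) _, fun g h => ?_⟩
    apply Subtype.ext
    have hgh : (⟨(((g * h : ↥(PiYdd C ⊓ J)) : Pi C) : D.PiTemp), hmem (g * h)⟩ : H') =
        ⟨((g : Pi C) : D.PiTemp), hmem g⟩ * ⟨((h : Pi C) : D.PiTemp), hmem h⟩ := rfl
    have k0 := κ.2.2 ⟨_, hmem g⟩ ⟨_, hmem h⟩
    rw [← hgh] at k0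
    have key := congrArg (fun a : D.DeltaTheta => (a : D.GtpTheta) ^ l) k0
    have hcomm : Commute ((κ.1 ⟨((g : Pi C) : D.PiTemp), hmem g⟩ : D.DeltaTheta) : D.GtpTheta)
        ((MulAut.conjNormal (D.toTheta ((g : Pi C) : D.PiTemp)) (κ.1 ⟨((h : Pi C) : D.PiTemp), hmem h⟩) :
          D.DeltaTheta) : D.GtpTheta) :=
      D.ker_thetaToEll_comm _ (κ.1 _).2 _ (MulAut.conjNormal _ (κ.1 _)).2
    change ((κ.1 ⟨(((g * h : ↥(PiYdd C ⊓ J)) : Pi C) : D.PiTemp), hmem (g * h)⟩ : D.DeltaTheta) : D.GtpTheta) ^ l =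
      ((κ.1 ⟨((g : Pi C) : D.PiTemp), hmem g⟩ : D.DeltaTheta) : D.GtpTheta) ^ l *
        (phi C g * ((κ.1 ⟨((h : Pi C) : D.PiTemp), hmem h⟩ : D.DeltaTheta) : D.GtpTheta) ^ l * (phi C g)⁻¹)
    simp only [Subgroup.coe_mul, MulAut.conjNormal_apply] at key hcomm ⊢
    rw [key, hcomm.mul_pow, conj_pow]
    rfl
  refine ⟨ContH1.mk F hF, ?_⟩
  -- `z^N` as the class of the pointwise `N`-th power
  have hzN : ∀ n : ℕ, ContH1.mk F hF ^ n = ContH1.mk (F ^ n) (pow_mem hF n) := by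
    intro n
    induction n with
    | zero =>
      rw [pow_zero]
      exact (ContH1.mk_one (H := PiYdd C ⊓ J)).symm.trans (ContH1.mk_congr (PiYdd C ⊓ J) (pow_zero F).symm _ _)
    | succ n ih =>
      rw [pow_succ, ih, ContH1.mk_mul_mk]
      exact ContH1.mk_congr (PiYdd C ⊓ J) (pow_succ F n).symm _ _
  -- the pointwise identity: `(κ_y(g))^(lN) = κ_{x'}(g)` in `Λ(Fn)`, hence in `Δ_Θ`
  have hpt : ∀ g : ↥(PiYdd C ⊓ J),
      (((κ.1 ⟨((g : Pi C) : D.PiTemp), hmem g⟩ : D.DeltaTheta) : D.GtpTheta) ^ l) ^ N =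
        ((T.coeff.hom (x'.kummerCocycle ha' ⟨((g : Pi C) : D.PiTemp),
          map_subtype_piYdd_inf_le_GtpYdd C J (hmem g)⟩) : D.DeltaTheta) : D.GtpTheta) := by
    intro g
    rw [← pow_mul, ← SubmonoidClass.coe_pow]
    congr 1
    change (T.coeff.hom (y.kummerCocycle hb ⟨((g : Pi C) : D.PiTemp), hmem g⟩)) ^ (l * N) = _
    rw [← map_pow]
    congr 1
    refine Subtype.ext (funext fun n => ?_)
    change (((⟨((g : Pi C) : D.PiTemp), hmem g⟩ : H') : D.PiTemp) • y.root n / y.root n) ^ (l * N) =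
      ((⟨((g : Pi C) : D.PiTemp), _⟩ : D.GtpYdd) : D.PiTemp) • x'.root n / x'.root n
    change (((g : Pi C) : D.PiTemp) • x'.root (M * n) / x'.root (M * n)) ^ (l * N) =
      ((g : Pi C) : D.PiTemp) • x'.root n / x'.root n
    rw [div_pow, ← smul_pow', show (l * N : ℕ) = ((M : ℕ+) : ℕ) from rfl, mul_comm M n, x'.root_mul_pow n M]
  -- the two `Δ_Θ`-images agree: both are the pull-back of the Kummer class of `σ•Θ̈`
  have hcc : ContH1.coeffChange (phi C) (D.lDeltaTheta_le l) (PiYdd C ⊓ J) (ContH1.mk F hF ^ N) =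
      ContH1.coeffChange (phi C) (D.lDeltaTheta_le l) (PiYdd C ⊓ J)
        (ContH1.res (phi C) (D.lDeltaTheta l) (inf_le_inf_left (PiYdd C) (le_top : J ≤ ⊤))
          (ContH1.conj (phi C) (D.lDeltaTheta l) σ (rootLiftClass C))) := by
    rw [coeffChange_res_conj_rootLiftClass, hη, ThetaSetting.ThetaKummerInput.kummerTheta,
      T.coeff.conj_kummerContClass D.GtpYdd (σ : D.PiTemp) T.thetaRoots T.theta_mem
        (fun _ => T.isOpen_stabilizer _) ha' hx',
      CyclotomeCoefficients.kummerContClass, ContH1.comap_mk, hzN N, ContH1.coeffChange_mk]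
    refine ContH1.mk_congr (PiYdd C ⊓ J) (funext fun g => Subtype.ext ?_) _ _
    rw [Subgroup.coe_inclusion, Pi.pow_apply, SubmonoidClass.coe_pow]
    exact hpt g
  -- hence the quotient is `l`-torsion
  exact isOfFinOrder_iff_pow_eq_one.mpr ⟨l, Nat.pos_of_ne_zero C.l_ne_zero,
    div_pow_l_eq_one_of_coeffChange_eq C J _ _ hcc⟩

/-! ### §3d. `hdiv` up to torsion at the model, and the «respectively» clause assembled -/

/-- **Every orbit class `σ·η̲̈^Θ` has, for every `N > 0`, an `N`-th root UP TO TORSION in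
`lim_J H¹(Π_Ÿ(Π)∣_J, l·Δ_Θ)`**, given `η̈^Θ = κ(Θ̈)` and that the `lN`-th root of `Θ̈` is defined at some finite-index
open level. [cite: Mochizuki2012, Prop 1.4 p.27] -/
theorem exists_torsionRoot_toLim_orbit (T : D.ThetaKummerInput) (hη : E.etaDd = T.kummerTheta)
    (hJ : ∀ M : ℕ+, ∃ J : Subgroup (Pi C), J.FiniteIndex ∧ IsOpen (J : Set (Pi C)) ∧
      ∀ g : Pi C, g ∈ PiYdd C ⊓ J → (g : D.PiTemp) • T.thetaRoots.root M = T.thetaRoots.root M)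
    (σ : Pi C) {N : ℕ} (hN : 0 < N) :
    ∃ x : (coh C).lim, IsOfFinAddOrder (N • x - (coh C).toLim ⊤
      ((h1Top C).symm (Additive.ofMul (ContH1.conj (phi C) (D.lDeltaTheta l) σ (rootLiftClass C))))) := by
  obtain ⟨J, hJf, hJo, hfix⟩ := exists_level_fixing_smul C σ _
    (hJ ⟨l * N, Nat.mul_pos (Nat.pos_of_ne_zero C.l_ne_zero) hN⟩)
  obtain ⟨z, hz⟩ := exists_pow_div_res_conj_rootLiftClass_torsion C T hη σ hN J hfix
  exact exists_nsmul_sub_toLim_isOfFinAddOrder_of_res (phi C) (D.lDeltaTheta l) (PiYdd C) J hJf hJo _ z N hz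

/-- **From orbit classes to all of `θ(Π)`, UP TO TORSION** (interface level, [IUTchII] Prop. 1.4 p. 27: `θ(Π)` =
the `μ_l`-multiples of the reciprocals of the orbit, `theta_eq`): if every orbit member has, for every `N > 0`, an
`N`-th root up to torsion in the limit, then so does every class of `θ(Π)` — a class of `θ(Π)` is `−o + s` with `o`
in the orbit and `l • s = 0` (`0 < l`). [claim: Mochizuki2012, status: disputed] (IUTchII §1 Prop 1.4, kurims p.27) -/
theorem _root_.Literature.IUT.HodgeArakelov.EtaleThetaData.torsionRoot_theta_of_orbit
    {S : ThetaSetting.{u}} {P : TopGroup.{u}} (D : EtaleThetaData S P) (hl : 0 < S.l)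
    (horb : ∀ o ∈ D.orbit, ∀ N : ℕ, 0 < N → ∃ x : D.coh.lim, IsOfFinAddOrder (N • x - D.coh.toLim ⊤ o)) :
    ∀ t ∈ D.theta, ∀ N : ℕ, 0 < N → ∃ x : D.coh.lim, IsOfFinAddOrder (N • x - D.coh.toLim ⊤ t) := by
  intro t ht N hN
  rw [D.theta_eq] at ht
  obtain ⟨o, ho, hlt⟩ := ht
  obtain ⟨x, hx⟩ := horb o ho N hN
  refine ⟨-x, ?_⟩
  have hs : IsOfFinAddOrder (D.coh.toLim ⊤ (t + o)) :=
    (D.coh.toLim ⊤).isOfFinAddOrder (isOfFinAddOrder_iff_nsmul_eq_zero.mpr ⟨S.l, hl, hlt⟩)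
  have heq : N • (-x) - D.coh.toLim ⊤ t = -(N • x - D.coh.toLim ⊤ o) + -(D.coh.toLim ⊤ (t + o)) := by
    rw [map_add, smul_neg]
    abel
  rw [heq]
  exact hx.neg.add hs.neg

/-- **`hdiv` UP TO TORSION at the model** (the divisibility input of the «respectively» clause, in print's
"up to torsion" form, [IUTchII] Prop. 1.4 p. 27): every class of `θ(Π_v)` at `D := etaleThetaDataOfSetting'` has,
for every `N > 0`, an `N`-th root up to torsion in the limit — GIVEN `η̈^Θ = κ(Θ̈)` (route R-8/R-9) and that every
root `Θ̈^{1/M}` of `T.thetaRoots` is fixed by `Π_Ÿ(Π_v) ∩ J` for some finite-index open `J ≤ Π_v` ([EtTh] §1 p. 20;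
[IUTchII] Prop. 1.4 «`J` ranges over the finite index open subgroups of `Π`»). The orbit of the model is the
one-root orbit `{σ·η̲̈^Θ}` (`etaleThetaDataOfSetting'_orbit`). [claim: Mochizuki2012, status: disputed]
(IUTchII §2 Prop 2.2 (ii), kurims p.66) -/
theorem hdivTorsion_etaleThetaDataOfSetting' (hC : D.Compat) (hS : D.Sec2Hyps) (hchar : PiYddCharacteristic C)
    (S : BadPlaceSetting.{0}) (eS : (Pi C) ≃ₜ* S.PiX) (hl : S.l = l)
    (T : D.ThetaKummerInput) (hη : E.etaDd = T.kummerTheta)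
    (hJ : ∀ M : ℕ+, ∃ J : Subgroup (Pi C), J.FiniteIndex ∧ IsOpen (J : Set (Pi C)) ∧
      ∀ g : Pi C, g ∈ PiYdd C ⊓ J → (g : D.PiTemp) • T.thetaRoots.root M = T.thetaRoots.root M) :
    ∀ t ∈ (etaleThetaDataOfSetting' C hC hS hchar S.toThetaSetting eS hl).theta, ∀ N : ℕ, 0 < N →
      ∃ x : (etaleThetaDataOfSetting' C hC hS hchar S.toThetaSetting eS hl).coh.lim,
        IsOfFinAddOrder (N • x - (etaleThetaDataOfSetting' C hC hS hchar S.toThetaSetting eS hl).coh.toLim ⊤ t) := by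
  refine (etaleThetaDataOfSetting' C hC hS hchar S.toThetaSetting eS hl).torsionRoot_theta_of_orbit
    (by rw [show S.toThetaSetting.l = S.l from rfl, hl]; exact Nat.pos_of_ne_zero C.l_ne_zero) ?_
  intro o ho N hN
  rw [etaleThetaDataOfSetting'_orbit] at ho
  obtain ⟨σ, rfl⟩ := ho
  exact exists_torsionRoot_toLim_orbit C T hη hJ σ hN

/-- **IUTchII:Prop2.2(ii)** «respectively» clause IN FULL at the model, with the divisibility binder `hdiv` of
abc-iut-w5-d187's `inftyClause_etaleThetaDataOfSetting'` DISCHARGED (in print's "up to torsion" form) by Kummer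
theory of the roots of `Θ̈`: `InftyClause` holds for every `IotaInvariantTheta'` datum over `etaleThetaDataOfSetting'`,
GIVEN (hfix) no nontrivial element of `(l·Δ_Θ)(Π_v)` is fixed by `Π_Ÿ(Π_v) ∩ K'` for a finite-index `K'` (the
cyclotomic character on open subgroups — a binder), `η̈^Θ = κ(Θ̈)` (`hη`), and the finite-level definability `hJ` of
the roots of `Θ̈`. [claim: Mochizuki2012, status: disputed] (IUTchII §2 Prop 2.2 (ii), kurims p.66) -/
theorem inftyClause_etaleThetaDataOfSetting'_of_thetaKummer (hC : D.Compat) (hS : D.Sec2Hyps)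
    (hchar : PiYddCharacteristic C) (S : BadPlaceSetting.{0}) (eS : (Pi C) ≃ₜ* S.PiX) (hl : S.l = l)
    {T₀ : TemperedCoverings S (Pi C)}
    {Dec : SubgraphDecomposition S T₀ (etaleThetaDataOfSetting' C hC hS hchar S.toThetaSetting eS hl)}
    (Θ : IotaInvariantTheta' Dec)
    (hfix : ∀ K' : Subgroup (Pi C), K'.FiniteIndex → ∀ a : ↥(D.lDeltaTheta l),
      (∀ n : Pi C, n ∈ PiYdd C ⊓ K' → MulAut.conjNormal (phi C n) a = a) → a = 1)
    (T : D.ThetaKummerInput) (hη : E.etaDd = T.kummerTheta)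
    (hJ : ∀ M : ℕ+, ∃ J : Subgroup (Pi C), J.FiniteIndex ∧ IsOpen (J : Set (Pi C)) ∧
      ∀ g : Pi C, g ∈ PiYdd C ⊓ J → (g : D.PiTemp) • T.thetaRoots.root M = T.thetaRoots.root M) :
    Θ.InftyClause :=
  Θ.inftyClause_of_ker_torsion_of_torsionRoot
    (toLim_top_ker_torsion_of_forall_fixed_eq_one (phi C) (D.lDeltaTheta l) (PiYdd C) hfix)
    (hdivTorsion_etaleThetaDataOfSetting' C hC hS hchar S eS hl T hη hJ)

end EtaleThetaDataOfSetting

end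

end Literature.IUT.HodgeArakelov
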